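import Literature.Geometry.Lorentzian.FlatChartComputations
import Literature.Geometry.Lorentzian.FlatChartIntegral
import Literature.Analysis.Calculus.PolarFluxIntegral
import HarnessLib

/-!
# The index flux at a critical point of a Morse function in a flat Morse chart: `±4π`

Let `(N, h)` be a Riemannian surface, `e` a chart of the maximal atlas centred at `p` with
`h = e^*δ` on the ball `B = B(0, r₁) ⊆ e.target` (`MetricFlattening.lean`) and `e⁻¹(B)` inside
the atlas chart domain at `p`, and let `f` be a smooth function which in the chart `e` is the
Morse normal form `f(e⁻¹ y) = c₀ + ε₀ y₀² + ε₁ y₁²`, `εᵢ = ±1` (Morse lemma). For a smooth cutoff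
`ψ̂` with compact support in `B` and `ψ = ψ̂ ∘ e` (extended by `0`), the flux of the
transgression field of `f` (`SurfaceCurvatureFlux.lean`) is

  `∫_N (⟨du, dψ⟩ − 2 Δf ⟨df, dψ⟩)/u dμ_h = 4π ε₀ ε₁ ψ̂(0)`,     `u = |∇f|²`

(`integral_flux_morseChart`): in the flat chart `u = 4|y|²`, `Δf = 2(ε₀ + ε₁)`, and the integrand
is `−2ε₀ε₁ (y·∇ψ̂)/|y|²` (`FlatChartComputations`), whose integral is `−2ε₀ε₁ · (−2π ψ̂(0))`
(`PolarFluxIntegral`). This is the index `ε₀ε₁ = (−1)^λ` of the critical point times `4π`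
(`= 2 · 2π`, the scalar curvature being `2K`), i.e. the local contribution `2π · index` of a
singularity of the frame `∇f/|∇f|` in the intrinsic proof of the Gauss–Bonnet theorem
(Chern 1944, §2). Also `integral_mul_scalarCurvature_eq_zero_of_flatOn`: `∫ φ S dμ = 0` for
`φ` supported in the flat region. Everything is proved; no definitions, no named facts.

## References

* S.-S. Chern, *A simple intrinsic proof of the Gauss–Bonnet formula for closed Riemannian
  manifolds*, Ann. of Math. 45 (1944), §2. [Chern1944]
* J. Milnor, *Morse theory*, Ann. of Math. Studies 51 (1963), Lemma 2.2 (Morse lemma).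
  [Milnor1963]
-/

noncomputable section

set_option maxSynthPendingDepth 3

open Bundle Set Function Filter Module TopologicalSpace MeasureTheory Manifold
open scoped Manifold ContDiff Topology RealInnerProductSpace

namespace Literature.Geometry.Lorentzian

open Literature.Geometry.Riemannian Literature.Analysis.Calculus PseudoRiemannianMetric

/-! ### Calculus of the Morse normal form on Euclidean space -/

section Quadratic

variable {n : ℕ} (ε : Fin n → ℝ) (c₀ : ℝ)

/-- The differential of `y ↦ c₀ + Σ εᵢ yᵢ²`: `Σᵢ 2 εᵢ zᵢ dyᵢ`. [folklore] -/
theorem hasFDerivAt_quadratic (z : EuclideanSpace ℝ (Fin n)) :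
    HasFDerivAt (fun y : EuclideanSpace ℝ (Fin n) ↦ c₀ + ∑ i, ε i * (y i) ^ 2)
      (∑ i, (2 * ε i * z i) • (EuclideanSpace.proj i : EuclideanSpace ℝ (Fin n) →L[ℝ] ℝ)) z := by
  have hterm : ∀ i, HasFDerivAt (fun y : EuclideanSpace ℝ (Fin n) ↦ ε i * (y i) ^ 2)
      ((2 * ε i * z i) • (EuclideanSpace.proj i : EuclideanSpace ℝ (Fin n) →L[ℝ] ℝ)) z := by
    intro i
    have h1 : HasFDerivAt (fun y : EuclideanSpace ℝ (Fin n) ↦ y i)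
        (EuclideanSpace.proj i : EuclideanSpace ℝ (Fin n) →L[ℝ] ℝ) z :=
      (EuclideanSpace.proj i : EuclideanSpace ℝ (Fin n) →L[ℝ] ℝ).hasFDerivAt
    have h2 := (h1.pow 2).const_mul (ε i)
    refine h2.congr_fderiv ?_
    ext v
    simp only [Nat.add_one_sub_one, pow_one, _root_.smul_apply, smul_eq_mul,
      PiLp.proj_apply]
    ring
  have hsum := HasFDerivAt.fun_sum (u := (Finset.univ : Finset (Fin n))) fun i _ ↦ hterm i
  have := hsum.const_add c₀
  simpa [Finset.sum_apply] using this

/-- `d(c₀ + Σ εᵢ yᵢ²)_z (v) = Σᵢ 2 εᵢ zᵢ vᵢ`. [folklore] -/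
theorem fderiv_quadratic_apply (z v : EuclideanSpace ℝ (Fin n)) :
    fderiv ℝ (fun y : EuclideanSpace ℝ (Fin n) ↦ c₀ + ∑ i, ε i * (y i) ^ 2) z v =
      ∑ i, 2 * ε i * z i * v i := by
  rw [(hasFDerivAt_quadratic ε c₀ z).fderiv]
  simp only [FunLike.coe_sum, Finset.sum_apply, _root_.smul_apply, smul_eq_mul,
    PiLp.proj_apply]

/-- The differential of `y ↦ c₀ + Σ εᵢ yᵢ²` as a function of the point. [folklore] -/
theorem fderiv_quadratic :
    fderiv ℝ (fun y : EuclideanSpace ℝ (Fin n) ↦ c₀ + ∑ i, ε i * (y i) ^ 2) =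
      fun z ↦ ∑ i, (2 * ε i * z i) • (EuclideanSpace.proj i : EuclideanSpace ℝ (Fin n) →L[ℝ] ℝ) :=
  funext fun z ↦ (hasFDerivAt_quadratic ε c₀ z).fderiv

/-- The second differential of `y ↦ c₀ + Σ εᵢ yᵢ²`: `Σᵢ 2 εᵢ dyᵢ ⊗ dyᵢ`. [folklore] -/
theorem hasFDerivAt_fderiv_quadratic (z : EuclideanSpace ℝ (Fin n)) :
    HasFDerivAt (fderiv ℝ (fun y : EuclideanSpace ℝ (Fin n) ↦ c₀ + ∑ i, ε i * (y i) ^ 2))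
      (∑ i, (2 * ε i) • (EuclideanSpace.proj i : EuclideanSpace ℝ (Fin n) →L[ℝ] ℝ).smulRight
        (EuclideanSpace.proj i : EuclideanSpace ℝ (Fin n) →L[ℝ] ℝ)) z := by
  rw [fderiv_quadratic]
  refine HasFDerivAt.fun_sum (u := (Finset.univ : Finset (Fin n)))
    (A := fun i (y : EuclideanSpace ℝ (Fin n)) ↦
      (2 * ε i * y i) • (EuclideanSpace.proj i : EuclideanSpace ℝ (Fin n) →L[ℝ] ℝ))
    (A' := fun i ↦ (2 * ε i) • (EuclideanSpace.proj i : EuclideanSpace ℝ (Fin n) →L[ℝ] ℝ).smulRight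
      (EuclideanSpace.proj i : EuclideanSpace ℝ (Fin n) →L[ℝ] ℝ)) fun i _ ↦ ?_
  have h1 : HasFDerivAt (fun y : EuclideanSpace ℝ (Fin n) ↦ 2 * ε i * y i)
      ((2 * ε i) • (EuclideanSpace.proj i : EuclideanSpace ℝ (Fin n) →L[ℝ] ℝ)) z := by
    have := ((EuclideanSpace.proj i : EuclideanSpace ℝ (Fin n) →L[ℝ] ℝ).hasFDerivAt (x := z)).const_mul
      (2 * ε i)
    simpa [PiLp.proj_apply] using this
  have h2 := h1.smul_const (EuclideanSpace.proj i : EuclideanSpace ℝ (Fin n) →L[ℝ] ℝ)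
  refine h2.congr_fderiv ?_
  ext v w
  simp [ContinuousLinearMap.smulRight_apply, PiLp.proj_apply]
  ring

/-- `d²(c₀ + Σ εᵢ yᵢ²)(v, w) = Σᵢ 2 εᵢ vᵢ wᵢ`. [folklore] -/
theorem fderiv_fderiv_quadratic_apply (z v w : EuclideanSpace ℝ (Fin n)) :
    fderiv ℝ (fderiv ℝ (fun y : EuclideanSpace ℝ (Fin n) ↦ c₀ + ∑ i, ε i * (y i) ^ 2)) z v w =
      ∑ i, 2 * ε i * v i * w i := by
  rw [(hasFDerivAt_fderiv_quadratic ε c₀ z).fderiv]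
  simp only [FunLike.coe_sum, Finset.sum_apply, _root_.smul_apply,
    ContinuousLinearMap.smulRight_apply, PiLp.proj_apply, smul_eq_mul]
  exact Finset.sum_congr rfl fun i _ ↦ by ring

/-- `‖y‖² = Σ yᵢ²` is the quadratic form with all `εᵢ = 1`; its differential is `Σ 2 zᵢ vᵢ`.
[folklore] -/
theorem fderiv_norm_sq_apply (z v : EuclideanSpace ℝ (Fin n)) :
    fderiv ℝ (fun y : EuclideanSpace ℝ (Fin n) ↦ ‖y‖ ^ 2) z v = ∑ i, 2 * z i * v i := by
  have heq : (fun y : EuclideanSpace ℝ (Fin n) ↦ ‖y‖ ^ 2) =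
      fun y ↦ (0 : ℝ) + ∑ i, (1 : ℝ) * (y i) ^ 2 := by
    funext y
    rw [EuclideanSpace.real_norm_sq_eq, zero_add]
    simp
  rw [heq, fderiv_quadratic_apply]
  simp

end Quadratic

/-! ### The flux at a flat Morse critical point -/

section Flux

variable {N : Type*} [TopologicalSpace N] [ChartedSpace (EuclideanSpace ℝ (Fin 2)) N]
  [IsManifold 𝓘(ℝ, EuclideanSpace ℝ (Fin 2)) ∞ N] [T2Space N] [T3Space N]
  [MeasurableSpace N] [BorelSpace N]
  (h : ContMDiffRiemannianMetric 𝓘(ℝ, EuclideanSpace ℝ (Fin 2)) ∞ (EuclideanSpace ℝ (Fin 2))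
    (TangentSpace 𝓘(ℝ, EuclideanSpace ℝ (Fin 2)) : N → Type _))
  [(ofRiemannian h).HasLeviCivita]
  {e : OpenPartialHomeomorph N (EuclideanSpace ℝ (Fin 2))}
  (he : e ∈ IsManifold.maximalAtlas 𝓘(ℝ, EuclideanSpace ℝ (Fin 2)) ∞ N) (p : N) {r₁ : ℝ}
  (hBe : Metric.ball (0 : EuclideanSpace ℝ (Fin 2)) r₁ ⊆ e.target)
  (hBc : e.symm '' Metric.ball (0 : EuclideanSpace ℝ (Fin 2)) r₁ ⊆
    (chartAt (EuclideanSpace ℝ (Fin 2)) p).source)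
  (hflat : ∀ z ∈ Metric.ball (0 : EuclideanSpace ℝ (Fin 2)) r₁, ∀ v w,
    h.inner (e.symm z) v w = (euclideanMetric (EuclideanSpace ℝ (Fin 2))).val z
      (mfderiv 𝓘(ℝ, EuclideanSpace ℝ (Fin 2)) 𝓘(ℝ, EuclideanSpace ℝ (Fin 2)) e (e.symm z) v)
      (mfderiv 𝓘(ℝ, EuclideanSpace ℝ (Fin 2)) 𝓘(ℝ, EuclideanSpace ℝ (Fin 2)) e (e.symm z) w))

include he hBe hflat in
omit [T2Space N] in
/-- **The scalar curvature integrates to zero against a function supported in the flat region.**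
[cite: Chern1944, §2] -/
theorem integral_mul_scalarCurvature_eq_zero_of_flatOn {φ : N → ℝ}
    (hφ : support φ ⊆ e.symm '' Metric.ball (0 : EuclideanSpace ℝ (Fin 2)) r₁) :
    ∫ x, φ x * (ofRiemannian h).scalarCurvature x ∂riemannianMeasure h = 0 := by
  refine integral_eq_zero_of_ae (Eventually.of_forall fun x ↦ ?_)
  by_cases hx : φ x = 0
  · simp [hx]
  · obtain ⟨z, hz, rfl⟩ := hφ (mem_support.2 hx)
    have hval : ∀ z ∈ Metric.ball (0 : EuclideanSpace ℝ (Fin 2)) r₁, ∀ v w,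
        (ofRiemannian h).val (e.symm z) v w = (euclideanMetric (EuclideanSpace ℝ (Fin 2))).val z
          (mfderiv 𝓘(ℝ, EuclideanSpace ℝ (Fin 2)) 𝓘(ℝ, EuclideanSpace ℝ (Fin 2)) e (e.symm z) v)
          (mfderiv 𝓘(ℝ, EuclideanSpace ℝ (Fin 2)) 𝓘(ℝ, EuclideanSpace ℝ (Fin 2)) e (e.symm z) w) :=
      fun z hz v w ↦ by rw [val_ofRiemannian]; exact hflat z hz v w
    simp only [Pi.zero_apply]
    rw [scalarCurvature_of_flatOn (ofRiemannian h) he Metric.isOpen_ball hBe hval hz, mul_zero]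

include he hBe hBc hflat in
/-- **The index flux at a flat Morse critical point.** With `f(e⁻¹ y) = c₀ + Σ εᵢ yᵢ²` on the chart
target (`εᵢ = ±1`), `ψ = ψ̂ ∘ e` for a smooth `ψ̂` compactly supported in the flat ball
`B(0, r₁)`, `u = |∇f|²_h` and `L = Δ_h f`:

  `∫_N (h⁻¹(du, dψ) − 2 L h⁻¹(df, dψ))/u dμ_h = 4π ε₀ε₁ ψ̂(0)`.

In the flat chart `u = 4|y|²`, `L = 2(ε₀ + ε₁)`, `h⁻¹(du,dψ) = 8 y·∇ψ̂`, `h⁻¹(df,dψ) = Σ 2εᵢyᵢ∂ᵢψ̂`,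
so the integrand is `−2ε₀ε₁ (y·∇ψ̂)/|y|²` and `∫ (y·∇ψ̂)/|y|² = −2π ψ̂(0)`
(`integral_radialDeriv_div_normSq_euclidean`): the local index `2π · ε₀ε₁` of the singularity of
the frame `∇f/|∇f|` at the critical point, doubled because `S = 2K` (Chern 1944, §2).
[cite: Chern1944, §2] [cite: Milnor1963, Lemma 2.2] -/
theorem integral_flux_morseChart {f : N → ℝ} (hf : ContMDiff 𝓘(ℝ, EuclideanSpace ℝ (Fin 2)) 𝓘(ℝ, ℝ) ∞ f) {ε : Fin 2 → ℝ}
    (hε : ∀ i, ε i = 1 ∨ ε i = -1) {c₀ : ℝ}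
    (hfq : ∀ y ∈ e.target, f (e.symm y) = c₀ + ∑ i, ε i * (y i) ^ 2)
    {ψh : EuclideanSpace ℝ (Fin 2) → ℝ} (hψh : ContDiff ℝ ∞ ψh) (hK : IsCompact (tsupport ψh))
    (hψB : tsupport ψh ⊆ Metric.ball (0 : EuclideanSpace ℝ (Fin 2)) r₁) :
    ∫ x, ((ofRiemannian h).innerDual x
            (mvfderiv 𝓘(ℝ, EuclideanSpace ℝ (Fin 2)) ((ofRiemannian h).gradSq f) x :
              TangentSpace 𝓘(ℝ, EuclideanSpace ℝ (Fin 2)) x →ₗ[ℝ] ℝ)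
            (mvfderiv 𝓘(ℝ, EuclideanSpace ℝ (Fin 2)) (chartCutoff e ψh) x :
              TangentSpace 𝓘(ℝ, EuclideanSpace ℝ (Fin 2)) x →ₗ[ℝ] ℝ)
          - 2 * (ofRiemannian h).dalembertian f x *
            (ofRiemannian h).innerDual x
              (mvfderiv 𝓘(ℝ, EuclideanSpace ℝ (Fin 2)) f x :
                TangentSpace 𝓘(ℝ, EuclideanSpace ℝ (Fin 2)) x →ₗ[ℝ] ℝ)
              (mvfderiv 𝓘(ℝ, EuclideanSpace ℝ (Fin 2)) (chartCutoff e ψh) x :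
                TangentSpace 𝓘(ℝ, EuclideanSpace ℝ (Fin 2)) x →ₗ[ℝ] ℝ)) /
          (ofRiemannian h).gradSq f x ∂riemannianMeasure h =
      4 * Real.pi * (ε 0 * ε 1) * ψh 0 := by
  set g := ofRiemannian h with hg
  set B := Metric.ball (0 : EuclideanSpace ℝ (Fin 2)) r₁ with hB
  set ψ := chartCutoff e ψh with hψ
  set u := g.gradSq f with hu
  set L := g.dalembertian f with hL
  have hBo : IsOpen B := Metric.isOpen_ball
  have hval : ∀ z ∈ B, ∀ v w, g.val (e.symm z) v w = (euclideanMetric (EuclideanSpace ℝ (Fin 2))).val z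
      (mfderiv 𝓘(ℝ, EuclideanSpace ℝ (Fin 2)) 𝓘(ℝ, EuclideanSpace ℝ (Fin 2)) e (e.symm z) v)
      (mfderiv 𝓘(ℝ, EuclideanSpace ℝ (Fin 2)) 𝓘(ℝ, EuclideanSpace ℝ (Fin 2)) e (e.symm z) w) :=
    fun z hz v w ↦ by rw [hg, val_ofRiemannian]; exact hflat z hz v w
  -- smoothness
  have hψB' : tsupport ψh ⊆ e.target := hψB.trans hBe
  have hψs : ContMDiff 𝓘(ℝ, EuclideanSpace ℝ (Fin 2)) 𝓘(ℝ, ℝ) ∞ ψ := contMDiff_chartCutoff he (contMDiff_iff_contDiff.2 hψh) hK hψB'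
  have hus : ContMDiff 𝓘(ℝ, EuclideanSpace ℝ (Fin 2)) 𝓘(ℝ, ℝ) ∞ u := contMDiff_gradSq g hf
  have hLs : ContMDiff 𝓘(ℝ, EuclideanSpace ℝ (Fin 2)) 𝓘(ℝ, ℝ) ∞ L := contMDiff_dalembertian g hf
  have h1le : (1 : ℕ∞ω) ≤ ∞ := WithTop.coe_le_coe.mpr le_top
  -- the integrand and its support
  set Fl : N → ℝ := fun x ↦ (g.innerDual x
      (mvfderiv 𝓘(ℝ, EuclideanSpace ℝ (Fin 2)) u x : TangentSpace 𝓘(ℝ, EuclideanSpace ℝ (Fin 2)) x →ₗ[ℝ] ℝ)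
      (mvfderiv 𝓘(ℝ, EuclideanSpace ℝ (Fin 2)) ψ x : TangentSpace 𝓘(ℝ, EuclideanSpace ℝ (Fin 2)) x →ₗ[ℝ] ℝ)
      - 2 * L x * g.innerDual x
        (mvfderiv 𝓘(ℝ, EuclideanSpace ℝ (Fin 2)) f x : TangentSpace 𝓘(ℝ, EuclideanSpace ℝ (Fin 2)) x →ₗ[ℝ] ℝ)
        (mvfderiv 𝓘(ℝ, EuclideanSpace ℝ (Fin 2)) ψ x : TangentSpace 𝓘(ℝ, EuclideanSpace ℝ (Fin 2)) x →ₗ[ℝ] ℝ)) / u x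
    with hFl
  have hψsupp : tsupport ψ ⊆ e.symm '' tsupport ψh := tsupport_chartCutoff_subset hK hψB'
  have hFl_supp : support Fl ⊆ e.symm '' B := by
    intro x hx
    rw [mem_support] at hx
    by_contra hxB
    have hxψ : x ∉ tsupport ψ := fun h' ↦ by
      obtain ⟨z, hz, rfl⟩ := hψsupp h'
      exact hxB ⟨z, hψB hz, rfl⟩
    have hd : mvfderiv 𝓘(ℝ, EuclideanSpace ℝ (Fin 2)) ψ x = 0 := mvfderiv_eq_zero_of_notMem_tsupport hxψ
    apply hx
    simp only [hFl, hd, innerDual, ContinuousLinearMap.toLinearMap_zero, map_zero, mul_zero,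
      sub_zero, zero_div]
  have hFl_meas : Measurable Fl := by
    have hc1 : Continuous fun x ↦ g.innerDual x
        (mvfderiv 𝓘(ℝ, EuclideanSpace ℝ (Fin 2)) u x : TangentSpace 𝓘(ℝ, EuclideanSpace ℝ (Fin 2)) x →ₗ[ℝ] ℝ)
        (mvfderiv 𝓘(ℝ, EuclideanSpace ℝ (Fin 2)) ψ x : TangentSpace 𝓘(ℝ, EuclideanSpace ℝ (Fin 2)) x →ₗ[ℝ] ℝ) :=
      continuous_innerDual_mvfderiv _ (hus.of_le h1le) (hψs.of_le h1le)
    have hc2 : Continuous fun x ↦ g.innerDual x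
        (mvfderiv 𝓘(ℝ, EuclideanSpace ℝ (Fin 2)) f x : TangentSpace 𝓘(ℝ, EuclideanSpace ℝ (Fin 2)) x →ₗ[ℝ] ℝ)
        (mvfderiv 𝓘(ℝ, EuclideanSpace ℝ (Fin 2)) ψ x : TangentSpace 𝓘(ℝ, EuclideanSpace ℝ (Fin 2)) x →ₗ[ℝ] ℝ) :=
      continuous_innerDual_mvfderiv _ (hf.of_le h1le) (hψs.of_le h1le)
    exact ((hc1.sub ((continuous_const.mul hLs.continuous).mul hc2)).measurable).div
      hus.continuous.measurable
  -- (1) the chart formula in the flat chart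
  have hstep1 : ∫ x, Fl x ∂riemannianMeasure h = ∫ z in B, Fl (e.symm z) :=
    integral_eq_integral_flatChart h he p hBo hBe hBc hflat hFl_meas hFl_supp
  -- (2) the integrand in the chart
  set qf : EuclideanSpace ℝ (Fin 2) → ℝ := fun y ↦ c₀ + ∑ i, ε i * (y i) ^ 2 with hqf
  have hε2 : ∀ i, ε i * ε i = 1 := fun i ↦ by rcases hε i with h | h <;> simp [h]
  have hfrep : ∀ z ∈ B, (f ∘ e.symm) =ᶠ[𝓝 z] qf := fun z hz ↦ by
    filter_upwards [e.open_target.mem_nhds (hBe hz)] with y hy using hfq y hy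
  have hψrep : ∀ z ∈ B, (ψ ∘ e.symm) =ᶠ[𝓝 z] ψh := fun z hz ↦ by
    filter_upwards [e.open_target.mem_nhds (hBe hz)] with y hy using chartCutoff_symm hy
  -- derivatives of the representatives
  have hdq : ∀ (y : EuclideanSpace ℝ (Fin 2)) (i : Fin 2),
      fderiv ℝ qf y (EuclideanSpace.single i 1) = 2 * ε i * y i := by
    intro y i
    rw [hqf, fderiv_quadratic_apply, Fin.sum_univ_two]
    fin_cases i <;> simp
  have hd2 : ∀ (y : EuclideanSpace ℝ (Fin 2)) (i : Fin 2),
      fderiv ℝ (fderiv ℝ qf) y (EuclideanSpace.single i 1) (EuclideanSpace.single i 1) = 2 * ε i := by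
    intro y i
    rw [hqf, fderiv_fderiv_quadratic_apply, Fin.sum_univ_two]
    fin_cases i <;> simp
  have hdn : ∀ (y : EuclideanSpace ℝ (Fin 2)) (i : Fin 2),
      fderiv ℝ (fun w : EuclideanSpace ℝ (Fin 2) ↦ 4 * ‖w‖ ^ 2) y (EuclideanSpace.single i 1) = 8 * y i := by
    intro y i
    have hdiff : DifferentiableAt ℝ (fun w : EuclideanSpace ℝ (Fin 2) ↦ ‖w‖ ^ 2) y := by
      have heq : (fun w : EuclideanSpace ℝ (Fin 2) ↦ ‖w‖ ^ 2) =
          fun w ↦ (0 : ℝ) + ∑ i, (1 : ℝ) * (w i) ^ 2 := by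
        funext w; rw [EuclideanSpace.real_norm_sq_eq, zero_add]; simp
      rw [heq]
      exact (hasFDerivAt_quadratic (fun _ ↦ (1 : ℝ)) 0 y).differentiableAt
    rw [fderiv_const_mul hdiff, _root_.smul_apply, smul_eq_mul, fderiv_norm_sq_apply, Fin.sum_univ_two]
    fin_cases i <;> simp <;> ring
  -- `u ∘ e⁻¹ = 4 |y|²` on `B`
  have hurep' : ∀ y ∈ B, u (e.symm y) = 4 * ‖y‖ ^ 2 := by
    intro y hy
    have hfm : MDifferentiableAt 𝓘(ℝ, EuclideanSpace ℝ (Fin 2)) 𝓘(ℝ, ℝ) f (e.symm y) :=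
      (hf _).mdifferentiableAt (by simp)
    rw [hu, gradSq_of_flatOn g he hBo hBe hval hy hfm, Fin.sum_univ_two, (hfrep y hy).fderiv_eq,
      hdq y 0, hdq y 1, EuclideanSpace.real_norm_sq_eq, Fin.sum_univ_two]
    linear_combination (4 * y 0 ^ 2) * hε2 0 + (4 * y 1 ^ 2) * hε2 1
  have hurep : ∀ z ∈ B, (u ∘ e.symm) =ᶠ[𝓝 z] fun y ↦ 4 * ‖y‖ ^ 2 := fun z hz ↦ by
    filter_upwards [hBo.mem_nhds hz] with y hy using hurep' y hy
  have hpoint : ∀ z ∈ B, Fl (e.symm z) =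
      -2 * (ε 0 * ε 1) * ((∑ i, z i * fderiv ℝ ψh z (EuclideanSpace.single i 1)) / ‖z‖ ^ 2) := by
    intro z hz
    have hfm : MDifferentiableAt 𝓘(ℝ, EuclideanSpace ℝ (Fin 2)) 𝓘(ℝ, ℝ) f (e.symm z) :=
      (hf _).mdifferentiableAt (by simp)
    have hum : MDifferentiableAt 𝓘(ℝ, EuclideanSpace ℝ (Fin 2)) 𝓘(ℝ, ℝ) u (e.symm z) :=
      (hus _).mdifferentiableAt (by simp)
    have hψm : MDifferentiableAt 𝓘(ℝ, EuclideanSpace ℝ (Fin 2)) 𝓘(ℝ, ℝ) ψ (e.symm z) :=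
      (hψs _).mdifferentiableAt (by simp)
    have hf2 : ContMDiffAt 𝓘(ℝ, EuclideanSpace ℝ (Fin 2)) 𝓘(ℝ, ℝ) 2 f (e.symm z) :=
      (hf _).of_le (WithTop.coe_le_coe.mpr le_top)
    -- the four quantities in the chart
    have hU : u (e.symm z) = 4 * ‖z‖ ^ 2 := hurep' z hz
    have hL' : L (e.symm z) = 2 * (ε 0 + ε 1) := by
      rw [hL, dalembertian_of_flatOn g he hBo hBe hval hz hf2, Fin.sum_univ_two,
        (hfrep z hz).fderiv.fderiv_eq, hd2 z 0, hd2 z 1]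
      ring
    have hPu : g.innerDual (e.symm z)
        (mvfderiv 𝓘(ℝ, EuclideanSpace ℝ (Fin 2)) u (e.symm z) :
          TangentSpace 𝓘(ℝ, EuclideanSpace ℝ (Fin 2)) (e.symm z) →ₗ[ℝ] ℝ)
        (mvfderiv 𝓘(ℝ, EuclideanSpace ℝ (Fin 2)) ψ (e.symm z) :
          TangentSpace 𝓘(ℝ, EuclideanSpace ℝ (Fin 2)) (e.symm z) →ₗ[ℝ] ℝ) =
        ∑ i, 8 * z i * fderiv ℝ ψh z (EuclideanSpace.single i 1) := by
      rw [innerDual_of_flatOn g he hBo hBe hval hz hum hψm]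
      refine Finset.sum_congr rfl fun i _ ↦ ?_
      rw [(hurep z hz).fderiv_eq, (hψrep z hz).fderiv_eq, hdn z i]
    have hPf : g.innerDual (e.symm z)
        (mvfderiv 𝓘(ℝ, EuclideanSpace ℝ (Fin 2)) f (e.symm z) :
          TangentSpace 𝓘(ℝ, EuclideanSpace ℝ (Fin 2)) (e.symm z) →ₗ[ℝ] ℝ)
        (mvfderiv 𝓘(ℝ, EuclideanSpace ℝ (Fin 2)) ψ (e.symm z) :
          TangentSpace 𝓘(ℝ, EuclideanSpace ℝ (Fin 2)) (e.symm z) →ₗ[ℝ] ℝ) =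
        ∑ i, 2 * ε i * z i * fderiv ℝ ψh z (EuclideanSpace.single i 1) := by
      rw [innerDual_of_flatOn g he hBo hBe hval hz hfm hψm]
      refine Finset.sum_congr rfl fun i _ ↦ ?_
      rw [(hfrep z hz).fderiv_eq, (hψrep z hz).fderiv_eq, hdq z i]
    -- algebra
    simp only [hFl]
    rw [hPu, hPf, hL', hU, Fin.sum_univ_two, Fin.sum_univ_two, Fin.sum_univ_two]
    set a := z 0 * fderiv ℝ ψh z (EuclideanSpace.single 0 1)
    set b := z 1 * fderiv ℝ ψh z (EuclideanSpace.single 1 1)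
    have hnum : 8 * z 0 * fderiv ℝ ψh z (EuclideanSpace.single 0 1) +
        8 * z 1 * fderiv ℝ ψh z (EuclideanSpace.single 1 1) -
        2 * (2 * (ε 0 + ε 1)) *
          (2 * ε 0 * z 0 * fderiv ℝ ψh z (EuclideanSpace.single 0 1) +
            2 * ε 1 * z 1 * fderiv ℝ ψh z (EuclideanSpace.single 1 1)) =
        (-2 * (ε 0 * ε 1) * (a + b)) * 4 := by
      simp only [a, b]
      linear_combination (-8 * z 0 * fderiv ℝ ψh z (EuclideanSpace.single 0 1)) * hε2 0 +
        (-8 * z 1 * fderiv ℝ ψh z (EuclideanSpace.single 1 1)) * hε2 1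
    rw [hnum]
    by_cases hz0 : ‖z‖ ^ 2 = 0
    · simp [hz0]
    · field_simp
  -- (3) assemble with the planar flux integral
  have hstep2 : ∫ z in B, Fl (e.symm z) =
      ∫ z in B, -2 * (ε 0 * ε 1) * ((∑ i, z i * fderiv ℝ ψh z (EuclideanSpace.single i 1)) / ‖z‖ ^ 2) :=
    setIntegral_congr_fun hBo.measurableSet hpoint
  have hzero : ∀ z, z ∉ B →
      -2 * (ε 0 * ε 1) * ((∑ i, z i * fderiv ℝ ψh z (EuclideanSpace.single i 1)) / ‖z‖ ^ 2) = 0 := by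
    intro z hz
    have hz' : z ∉ tsupport ψh := fun h' ↦ hz (hψB h')
    simp [fderiv_eq_zero_of_notMem_tsupport' hz']
  have hstep3 : ∫ z in B, -2 * (ε 0 * ε 1) * ((∑ i, z i * fderiv ℝ ψh z (EuclideanSpace.single i 1)) / ‖z‖ ^ 2) =
      ∫ z, -2 * (ε 0 * ε 1) * ((∑ i, z i * fderiv ℝ ψh z (EuclideanSpace.single i 1)) / ‖z‖ ^ 2) :=
    setIntegral_eq_integral_of_forall_compl_eq_zero hzero
  have hψ1 : ContDiff ℝ 1 ψh := hψh.of_le (by norm_cast)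
  have hψc : HasCompactSupport ψh := hK
  show ∫ x, Fl x ∂riemannianMeasure h = _
  rw [hstep1, hstep2, hstep3, integral_const_mul, integral_radialDeriv_div_normSq_euclidean hψ1 hψc]
  ring

end Flux

end Literature.Geometry.Lorentzian

end
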